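import Summits.MatrixMultiplication.OmegaCensus.SmallFormats.MatMul225GF3MarginalOrbit
import HarnessLib

/-!
# ω-census family (a): deflation matrices `A R = 1`, `A c = 0`, `ν R = 0` exist for every pair `(c, ν)` with `ν · c ≠ 0` (any field)

Cell `pub-omega` (unit `pub-omega-tensor`, gen 40), topic `Summits/MatrixMultiplication/OmegaCensus` (sub-folder
`SmallFormats`). Framing (verbatim): lottery ticket; floor = certified bounds/negative ranges. HONEST FRAMING: linear-algebra plumbing
for §1 of memo DEFLATION-g40: `MatMul22nDeflation` (p735828) deflates a computation of `⟨2,2,n+1⟩` along matrices `A : n × (n+1)`,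
`R : (n+1) × n` with `A R = 1`, killing the terms whose Y-form rows are multiples of a vector `c` with `A c = 0` or whose output rows are
multiples of a covector `ν` with `ν R = 0`; here: for EVERY `c, ν ∈ k^{n+1}` with `ν ⬝ᵥ c ≠ 0` such a pair exists (`A` = coordinates, in a
basis of the hyperplane `ker(ν ⬝ᵥ ·)`, of the projection along `c`; `R` = that basis as columns). Independent of p735828 (no import), so that
the two can be combined by any later file. Nothing here is a bound on any rank; nothing on `ω`.
-/

namespace Summit.MatrixMultiplication.OmegaCensus.SmallFormats

open Finset Module Matrix

namespace Deflation

variable {k : Type*} [Field k] {n : ℕ}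

/-- **Deflation matrices from a pair `(c, ν)` with `ν ⬝ᵥ c ≠ 0`:** there are `A : n × (n+1)` and `R : (n+1) × n` over `k` with
`A R = 1`, `A c = 0` and `ν R = 0`. -/
theorem exists_AR_of_dotProduct_ne_zero (c ν : Fin (n + 1) → k) (h : ν ⬝ᵥ c ≠ 0) :
    ∃ (A : Matrix (Fin n) (Fin (n + 1)) k) (R : Matrix (Fin (n + 1)) (Fin n) k),
      A * R = 1 ∧ A.mulVec c = 0 ∧ Matrix.vecMul ν R = 0 := by
  classical
  -- the functional `x ↦ ν ⬝ᵥ x` and its kernel `H`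
  let f : (Fin (n + 1) → k) →ₗ[k] k :=
    { toFun := fun x => ν ⬝ᵥ x
      map_add' := fun x y => dotProduct_add ν x y
      map_smul' := fun a x => by rw [dotProduct_smul, RingHom.id_apply] }
  have hf : ∀ x, f x = ν ⬝ᵥ x := fun x => rfl
  have hfc : f c ≠ 0 := h
  let H : Submodule k (Fin (n + 1) → k) := LinearMap.ker f
  have hsurj : Function.Surjective f := by
    intro a
    refine ⟨(a / f c) • c, ?_⟩
    rw [map_smul, smul_eq_mul, div_mul_cancel₀ a hfc]
  have hH : finrank k H = n := by
    have h1 := LinearMap.finrank_range_add_finrank_ker f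
    rw [LinearMap.range_eq_top.mpr hsurj, finrank_top, Module.finrank_self, Module.finrank_fin_fun] at h1
    change finrank k (LinearMap.ker f) = n
    omega
  let b : Basis (Fin n) k H := Module.finBasisOfFinrankEq k H hH
  -- the projection onto `H` along `c`
  let π : (Fin (n + 1) → k) →ₗ[k] (Fin (n + 1) → k) :=
    LinearMap.id - (f c)⁻¹ • (LinearMap.toSpanSingleton k (Fin (n + 1) → k) c).comp f
  have hπ : ∀ x, π x = x - (f c)⁻¹ • (f x • c) := fun x => rfl
  have hπ_mem : ∀ x, π x ∈ H := by
    intro x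
    rw [LinearMap.mem_ker, hπ, map_sub, map_smul, map_smul, smul_eq_mul, smul_eq_mul, mul_comm (f x) (f c),
      inv_mul_cancel_left₀ hfc, sub_self]
  let πH : (Fin (n + 1) → k) →ₗ[k] H := LinearMap.codRestrict H π hπ_mem
  have hπH : ∀ x, (πH x : Fin (n + 1) → k) = π x := fun x => rfl
  have hπH_c : πH c = 0 := by
    apply Subtype.ext
    rw [hπH, hπ, smul_smul, inv_mul_cancel₀ hfc, one_smul, sub_self]
    rfl
  have hπH_id : ∀ x : H, πH (x : Fin (n + 1) → k) = x := by
    intro x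
    apply Subtype.ext
    rw [hπH, hπ, LinearMap.mem_ker.mp x.2, zero_smul, smul_zero, sub_zero]
  -- the matrices
  let A : Matrix (Fin n) (Fin (n + 1)) k := fun l j => b.repr (πH (Pi.single j 1)) l
  let R : Matrix (Fin (n + 1)) (Fin n) k := fun j l => (b l : Fin (n + 1) → k) j
  -- linearity bookkeeping: `∑_j x_j · repr(πH e_j)_l = repr(πH x)_l`
  have key : ∀ (x : Fin (n + 1) → k) (l : Fin n), ∑ j, x j * b.repr (πH (Pi.single j 1)) l = b.repr (πH x) l := by
    intro x l
    have hx : x = ∑ j, x j • (Pi.single j (1 : k) : Fin (n + 1) → k) := by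
      ext i
      simp only [Finset.sum_apply, Pi.smul_apply, Pi.single_apply, smul_eq_mul, mul_ite, mul_one, mul_zero]
      rw [Finset.sum_ite_eq Finset.univ i (fun j => x j)]
      simp
    have hπx : πH x = ∑ j, x j • πH (Pi.single j 1) := by
      conv_lhs => rw [hx]
      rw [map_sum]
      exact Finset.sum_congr rfl fun j _ => by rw [map_smul]
    rw [hπx, map_sum, Finsupp.finsetSum_apply]
    exact Finset.sum_congr rfl fun j _ => by rw [map_smul, Finsupp.smul_apply, smul_eq_mul]
  refine ⟨A, R, ?_, ?_, ?_⟩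
  · ext l l'
    rw [Matrix.mul_apply, Matrix.one_apply]
    have : ∑ j, A l j * R j l' = ∑ j, (b l' : Fin (n + 1) → k) j * b.repr (πH (Pi.single j 1)) l :=
      Finset.sum_congr rfl fun j _ => mul_comm _ _
    rw [this, key, hπH_id, b.repr_self, Finsupp.single_apply]
    by_cases hl : l = l'
    · subst hl; simp
    · simp [hl, Ne.symm hl]
  · ext l
    rw [Matrix.mulVec, dotProduct, Pi.zero_apply]
    have : ∑ j, A l j * c j = ∑ j, c j * b.repr (πH (Pi.single j 1)) l := Finset.sum_congr rfl fun j _ => mul_comm _ _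
    rw [this, key, hπH_c, map_zero, Finsupp.zero_apply]
  · ext l
    rw [Matrix.vecMul, dotProduct, Pi.zero_apply]
    change ∑ j, ν j * (b l : Fin (n + 1) → k) j = 0
    have hmem := (b l).2
    rw [LinearMap.mem_ker, hf] at hmem
    exact hmem

end Deflation

end Summit.MatrixMultiplication.OmegaCensus.SmallFormats
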